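import Literature.MathematicalPhysics.QuantumFieldTheory.Balaban1983to89.T4HistoryLipschitzCubeGeometry
import Literature.NumberTheory.LFunctions.DeBruijnNewmanProofs

/-!
# T4HistoryLipschitzLastCoupling (v1) — the explicit last-coupling modulus of the NE9 step inequality FROM HOLOMORPHY IN THE
LAST COUPLING: `LastCouplingLipschitz … (4B_k/ϱ)` by the Cauchy bound with a margin; the lineage's end-to-end theorem with
the last qualitative binder replaced by an analytic one of printed type

Trunk: ConstructiveQFT / Bałaban 1983–89, T⁴ output-rate estimate NE9 (`T4OutputRate.NE9`, coupling-history Lipschitz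
continuity with fading memory), lineage NE9-P2 (inductive route: a Lipschitz modulus propagated through the RG recursion).
Rung (B)+1 on a FIXED FINITE T⁴ — not infinite volume, not a mass gap, not the Clay problem; nothing of [I]–[III] is
asserted.

WHAT THIS LEAF DOES.  After `T4HistoryLipschitzCubeGeometry` the displayed hypotheses of the lineage's reduction of
NE9 ∧ FadingMemory are: printed-STRUCTURE binders of the recursion, the analytic decay bound (A) of the activity majorant,
scalars, the cube chart — and ONE binder still of merely qualitative printed type, `LastCouplingLipschitz E W T Ψ κ lam`
(`T4HistoryLipschitzOuter` §1): a Lipschitz MODULUS `lam k` of the new term in its explicit last coupling `g_k` (through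
`Ψ k s` and through the channel's own coupling argument).  Print gives the dependence on the last coupling qualitatively:
[I] p.263 «It is a C^∞-function of g_{j−1} ∈ [0, γ], (or analytic), with a positive, absolute γ.» next to the size bound
(1.18) «|𝐄^{(j)}(X, g_{j−1}, 𝐔, 𝐉)| ≤ E₀ exp(−κd_j(X))»; no modulus is printed.  Here the modulus is DERIVED, with the
explicit value `4B_k/ϱ`, from the binder `HoloInLastCoupling E W T Ψ κ B ϱ` (NOT PRINTED; printed TYPE = the two sentences
just quoted, complexified): for every history `g ∈ W`, step `k`, background and scale-(k+1) domain, the real function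
«coupling value `s = g′_k` of a window history ↦ the new term `Ψ k s (T k g′ (E g))`» is the restriction of ONE function
`φ` holomorphic on a complex domain containing the closed `ϱ`-discs about the window's coupling values and bounded there by
`B_k·e^{−κd(X)}` (this also records the printed STRUCTURE that the step-k channel reads its coupling argument only through
`g_k`: [I] (2.13) p.268, the exponent `𝐏^{(k)}(g_k, U_{k+1}, B) + {…}`).  The tool is the tree's Cauchy-with-margin lemma
`Dimock2015.norm_sub_le_of_margin` (constant `4M/ϱ`), exactly as `T4HistoryLipschitzOuter` §2–§5 treat the TABLE
variables; so after this leaf every analytic input of the lineage is displayed in the same currency — holomorphy + a sup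
bound on a complex neighbourhood of the occurring real data, with an explicit margin.
* §1 `HoloInLastCoupling`, `lastCouplingLipschitz_of_holo : 0 < ϱ → HoloInLastCoupling E W T Ψ κ B ϱ →
  LastCouplingLipschitz E W T Ψ κ (fun k => 4 * B k / ϱ)`.
* §2 the END-TO-END theorem of the lineage on a cube chart with `hlast` replaced: `ne9_and_fadingMemory_of_decay_holo`
  (moduli `prodModuli (4B̄/ϱ) (ω + 4a₁τ̄/(R₀ − s₀))`, `B k ≤ B̄`).
* §3 non-vacuity: `Ψ k s P U X = e^{−κd(X)}·cos s` satisfies `HoloInLastCoupling` with `B k = e^{ϱ}` on the strip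
  `|Im z| ≤ ϱ` (`toy_holoInLastCoupling`; the strip bound `‖cos z‖ ≤ e^{|Im z|}` is reused from the tree,
  `Literature.NumberTheory.LFunctions.norm_cos_le_exp_abs_im`), for ANY window, channel and functional.

ABSOLUTE RULE respected: nothing is cited as a fact; [I] = Bałaban CMP 109 (1987) p.263 (render
`1987-cmp109-rg-I-small-field-p015`) and p.268 are quoted for TYPES only; the binder is displayed as NOT PRINTED.
HONEST SCOPE: one Cauchy estimate and a composition; NOT an estimate on Bałaban's terms, NOT summit progress.

References: [Balaban1987RG1] T. Bałaban, CMP 109 (1987), p.263 (1.18), p.268 (2.13); [DimockYuan2024GNFlow] (the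
Cauchy-with-margin shape, via the tree's `Dimock2015.AnalyticLipschitz`).
-/

noncomputable section

namespace Literature.MathematicalPhysics.QuantumFieldTheory.Balaban1983to89.T4HistoryLipschitzLastCoupling

open scoped BigOperators
open Metric Set MeasureTheory
open Literature.Probability.LatticeModels
open Literature.MathematicalPhysics.QuantumFieldTheory.Balaban1983to89.T4OutputRate
open Literature.MathematicalPhysics.QuantumFieldTheory.Balaban1983to89.T4HistoryLipschitzRecursion
open Literature.MathematicalPhysics.QuantumFieldTheory.Balaban1983to89.T4HistoryLipschitzOuter
open Literature.MathematicalPhysics.QuantumFieldTheory.Balaban1983to89.T4HistoryLipschitzActivity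
open Literature.MathematicalPhysics.QuantumFieldTheory.Balaban1983to89.T4HistoryLipschitzEntropy
open Literature.MathematicalPhysics.QuantumFieldTheory.Balaban1983to89.T4HistoryLipschitzCubeGeometry
open Literature.MathematicalPhysics.QuantumFieldTheory.Balaban1983to89.T4HistoryLipschitzActivity (ClusterGeom)
open Literature.MathematicalPhysics.QuantumFieldTheory.Dimock2015

variable {C : Carriers}

/-! ## §1 Holomorphy in the last coupling ⇒ the explicit last-coupling modulus -/

/-- SHAPE (binder, NOT PRINTED; printed TYPE: [I] p.263 «It is a C^∞-function of g_{j−1} ∈ [0, γ], (or analytic), with a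
positive, absolute γ.» and (1.18) «|𝐄^{(j)}(X, g_{j−1}, 𝐔, 𝐉)| ≤ E₀ exp(−κd_j(X))», complexified): **HOLOMORPHY IN THE LAST
COUPLING with a margin** — for every window history `g`, step `k`, background `U` and scale-(k+1) domain `X` there is ONE
function `φ`, complex differentiable on a domain `D ⊆ ℂ` containing the closed `ϱ`-discs about the coupling values `g′ k`
of all window histories and bounded by `B k·e^{−κ d(X)}` on `D`, whose value at `g′ k` is the new term at last coupling
`g′ k` with the channel read at coupling argument `g′` on the terms of `g` (so the channel reads its coupling argument only
through `g′ k` — printed STRUCTURE, [I] (2.13) p.268). [cite: Balaban1987RG1, p.263 (1.18), p.268 (2.13)] -/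
def HoloInLastCoupling {Bg ι : Type} (E : Functional C Bg) (W : Set (ℕ → ℝ))
    (T : ℕ → (ℕ → ℝ) → (Bg → C.Dom → ℝ) → ι → ℝ) (Ψ : ℕ → ℝ → (ι → ℝ) → Bg → C.Dom → ℝ) (κ : ℝ) (B : ℕ → ℝ)
    (ϱ : ℝ) : Prop :=
  ∀ g ∈ W, ∀ (k : ℕ) (U : Bg) (X : C.Dom), C.scale X = k + 1 →
    ∃ (φ : ℂ → ℂ) (D : Set ℂ), DifferentiableOn ℂ φ D ∧ (∀ z ∈ D, ‖φ z‖ ≤ B k * Real.exp (-(κ * C.d X))) ∧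
      (∀ g' ∈ W, closedBall ((g' k : ℝ) : ℂ) ϱ ⊆ D) ∧
      (∀ g' ∈ W, φ ((g' k : ℝ) : ℂ) = ((Ψ k (g' k) (T k g' (E g)) U X : ℝ) : ℂ))

/-- **THE LAST-COUPLING MODULUS FROM HOLOMORPHY (kernel)**: `HoloInLastCoupling E W T Ψ κ B ϱ` with margin `ϱ > 0` gives
`LastCouplingLipschitz E W T Ψ κ (4B_k/ϱ)` — the tree's Cauchy bound with a margin (`Dimock2015.norm_sub_le_of_margin`,
constant `4M/ϱ` with `M = B k·e^{−κd(X)}`) applied on `ℂ` to `φ` with comparison set = the window's coupling values.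
[cite: DimockYuan2024GNFlow, proof of Thm 4 (arXiv:2303.07916v3 TeX ll. 4073-4076); Balaban1987RG1, p.263 (1.18)] -/
theorem lastCouplingLipschitz_of_holo {Bg ι : Type} {E : Functional C Bg} {W : Set (ℕ → ℝ)}
    {T : ℕ → (ℕ → ℝ) → (Bg → C.Dom → ℝ) → ι → ℝ} {Ψ : ℕ → ℝ → (ι → ℝ) → Bg → C.Dom → ℝ} {κ : ℝ} {B : ℕ → ℝ}
    {ϱ : ℝ} (hϱ : 0 < ϱ) (h : HoloInLastCoupling E W T Ψ κ B ϱ) :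
    LastCouplingLipschitz E W T Ψ κ (fun k => 4 * B k / ϱ) := by
  intro g hg g' hg' k U X hX
  obtain ⟨φ, D, hφ, hB, hD, hval⟩ := h g hg k U X hX
  set S : Set ℂ := (fun g'' : ℕ → ℝ => ((g'' k : ℝ) : ℂ)) '' W with hSdef
  have hS : ∀ y ∈ S, closedBall y ϱ ⊆ D := by
    rintro _ ⟨g'', hg'', rfl⟩
    exact hD g'' hg''
  have key := norm_sub_le_of_margin (g := φ) hϱ hφ hB hS
    (mem_image_of_mem (fun g'' : ℕ → ℝ => ((g'' k : ℝ) : ℂ)) hg)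
    (mem_image_of_mem (fun g'' : ℕ → ℝ => ((g'' k : ℝ) : ℂ)) hg')
  rw [hval g hg, hval g' hg', ← Complex.ofReal_sub, Complex.norm_real, ← Complex.ofReal_sub, Complex.norm_real,
    Real.norm_eq_abs, Real.norm_eq_abs] at key
  calc |Ψ k (g k) (T k g (E g)) U X - Ψ k (g' k) (T k g' (E g)) U X|
      ≤ 4 * (B k * Real.exp (-(κ * C.d X))) / ϱ * |g k - g' k| := key
    _ = Real.exp (-(κ * C.d X)) * (4 * B k / ϱ * |g k - g' k|) := by ring

/-- A uniform bound `B k ≤ B̄` on the holomorphy constants bounds the derived moduli: `4B_k/ϱ ≤ 4B̄/ϱ`. [folklore] -/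
theorem lastModulus_le {B : ℕ → ℝ} {Bbar ϱ : ℝ} (hϱ : 0 < ϱ) (hB : ∀ k, B k ≤ Bbar) (k : ℕ) :
    4 * B k / ϱ ≤ 4 * Bbar / ϱ :=
  div_le_div_of_nonneg_right (by linarith [hB k]) hϱ.le

/-! ## §2 END-TO-END on a cube chart with the last-coupling binder analytic

`T4HistoryLipschitzCubeGeometry.CubeChart.ne9_and_fadingMemory_of_decay` with `hlast : LastCouplingLipschitz … lam`,
`hlam : lam ≤ ℓ`, `hℓ : 0 ≤ ℓ` replaced by `HoloInLastCoupling … B ϱ`, `B k ≤ B̄`, `0 ≤ B̄`, `0 < ϱ`; moduli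
`prodModuli (4B̄/ϱ) (ω + 4a₁τ̄/(R₀ − s₀))`.  DISPLAYED after this leaf: the printed-STRUCTURE binders (`ScaleZeroFree`,
`AdmissibleTerms`, `AdmRestrict`, `ChannelAdditive`, `ChannelStepSum`, `Factorises`, the read-out `ρ`/`hΨ`), the printed
per-step channel SIZE bound in its creation-step-weighted reading (`ChannelSizeAtStepNN`, G-ne9p2-4 SUPPORTED), and the
ANALYTIC inputs, all of one currency and all NOT PRINTED as stated: (A) the decay of the configuration-free activity
majorant uniformly over tables of norm `< R₀` (G-ne9p2-5 (i)), (L) holomorphy in the last coupling with a margin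
(`HoloInLastCoupling`), the occupation bound `s₀ < R₀`; plus scalars and the cube chart. -/

section EndToEnd

open BoundedContinuousFunction

variable {α : Type} [DecidableEq α] {adj : α → α → Prop} [DecidableRel adj] [Std.Symm adj] {Dg : ℕ}
  (Γ : CubeChart C α adj Dg)
variable {Bg : Type} {Sp : Type*} [TopologicalSpace Sp] [MeasurableSpace Sp] [OpensMeasurableSpace Sp] {F : Type*}
  [Fintype F] {Ω : Type*} [MeasurableSpace Ω]

/-- **NE9 ∧ FADING MEMORY ON A CUBE CHART, LAST-COUPLING BINDER ANALYTIC (kernel end-to-end).**  See the §2 header for the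
displayed list. [cite: Balaban1987RG1, p.263 (1.18); Balaban1988RG2Cluster, (2.11)-(2.13) p.14, (2.30) p.18, Lemma 3 (2.38)
p.20; KoteckyPreiss1986, (1)-(3)] -/
theorem ne9_and_fadingMemory_of_decay_holo {ι : Type} {E : Functional C Bg} {W : Set (ℕ → ℝ)}
    {Adm : Set (Bg → C.Dom → ℝ)} {T : ℕ → (ℕ → ℝ) → (Bg → C.Dom → ℝ) → ι → ℝ}
    {Ψ : ℕ → ℝ → (ι → ℝ) → Bg → C.Dom → ℝ}
    {μ : ℕ → ℝ → Bg → Finset α → Measure Ω} {pre : ℕ → ℝ → Bg → Finset α → Ω → ℂ}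
    {c : ℕ → ℝ → Bg → Finset α → Ω → F → ℂ} {pt : ℕ → ℝ → Bg → Finset α → Ω → F → Sp}
    {l : ℕ → ℝ → Bg → Finset α → ℝ} {R₀ s₀ : ℝ} {ε : ℕ → ℝ} {y a₁ d₁ θ κ τbar ω ϱ Bbar : ℝ}
    {wt : ℕ → ι → ℝ} {τ : ℕ → ℕ → ℝ} {Bl : ℕ → ℝ} (ρ : ℕ → (ι → ℝ) → (Sp →ᵇ ℂ))
    -- recursion side (displayed, named binders of the sibling leaves)
    (h0 : ScaleZeroFree E W) (hAdm : AdmissibleTerms E W Adm) (hres : AdmRestrict Adm)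
    (hadd : ChannelAdditive Adm T) (hsum : ChannelStepSum Adm T) (hstep : ChannelSizeAtStepNN Adm T κ wt τ)
    (hfac : Factorises E W T Ψ)
    -- (L) holomorphy in the last coupling with a margin (displayed, replaces `LastCouplingLipschitz`)
    (hϱ : 0 < ϱ) (hhol : HoloInLastCoupling E W T Ψ κ Bl ϱ) (hBl : ∀ k, Bl k ≤ Bbar) (hBbar : 0 ≤ Bbar)
    (hρ : ∀ (k : ℕ) (P P' : ι → ℝ) (M : ℝ), (∀ y, |P y - P' y| ≤ wt k y * M) → ‖ρ k P - ρ k P'‖ ≤ M)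
    (hΨ : ∀ (k : ℕ) (s : ℝ) (P P' : ι → ℝ) (U : Bg) (X : C.Dom),
      Ψ k s P U X - Ψ k s P' U X =
        (Γ.geom.newTerm (Γ.geom.avgExpLinearAct μ pre fun k s U γ ω => evalFunctional (c k s U γ ω) (pt k s U γ ω))
            k s U X (ρ k P) -
          Γ.geom.newTerm (Γ.geom.avgExpLinearAct μ pre fun k s U γ ω => evalFunctional (c k s U γ ω) (pt k s U γ ω))
            k s U X (ρ k P')).re)
    (hocc : ∀ g ∈ W, ∀ g' ∈ W, ∀ k : ℕ, ‖ρ k (T k g' (E g))‖ ≤ s₀) (hsR : s₀ < R₀) (hR : 0 ≤ R₀)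
    -- activity side: regularity data and (A) the decay of the configuration-free majorant (displayed)
    (hpre : ∀ k s U γ, Integrable (pre k s U γ) (μ k s U γ))
    (hc : ∀ k s U γ Y, AEStronglyMeasurable (fun ω => c k s U γ ω Y) (μ k s U γ))
    (hpt : ∀ k s U γ Y, Measurable fun ω => pt k s U γ ω Y)
    (hl : ∀ k s U γ ω, ∑ Y, ‖c k s U γ ω Y‖ ≤ l k s U γ) (hε : ∀ k, 0 ≤ ε k) (hy : 0 ≤ y)
    (hdecay : ∀ g ∈ W, ∀ (k : ℕ) (U : Bg) (X : C.Dom), C.scale X = k + 1 → ∀ γ' ∈ Γ.vol X,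
      Γ.geom.avgExpLinearMajorant μ pre l R₀ k (g k) U γ' ≤ ε k * y ^ γ'.card)
    -- (C) scalar smallness and the envelope data
    (hθ : y * Real.exp (a₁ + d₁) * Real.exp (Dg * θ) ≤ θ) (hεθ : ∀ k, ε k * θ * ((Dg : ℝ) + 1) ≤ a₁)
    (ha₁ : 0 ≤ a₁) (hκ : 0 ≤ κ) (hκd : κ ≤ d₁) (hτbar : 0 ≤ τbar) (hω : 0 ≤ ω)
    (hpos : 0 < ω + 4 * a₁ / (R₀ - s₀) * τbar)
    (hτ : ∀ k j, j ≤ k → 0 ≤ τ k j ∧ τ k j ≤ τbar * ω ^ (k - j)) :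
    NE9 E W κ (prodModuli (4 * Bbar / ϱ) fun _ => ω + 4 * a₁ / (R₀ - s₀) * τbar) ∧
      FadingMemory (4 * Bbar / ϱ / (ω + 4 * a₁ / (R₀ - s₀) * τbar)) (ω + 4 * a₁ / (R₀ - s₀) * τbar)
        (prodModuli (4 * Bbar / ϱ) fun _ => ω + 4 * a₁ / (R₀ - s₀) * τbar) :=
  Γ.ne9_and_fadingMemory_of_decay ρ h0 hAdm hres hadd hsum hstep hfac (lastCouplingLipschitz_of_holo hϱ hhol) hρ hΨ
    hocc hsR hR hpre hc hpt hl hε hy hdecay hθ hεθ ha₁ hκ hκd (by positivity) hτbar hω hpos (lastModulus_le hϱ hBl) hτ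

end EndToEnd

/-! ## §3 Non-vacuity of the binder: an entire last-coupling dependence with a strip bound

(`‖cos z‖ ≤ e^{|Im z|}` is the tree's `Literature.NumberTheory.LFunctions.norm_cos_le_exp_abs_im`, imported by name.) -/

/-- **NON-VACUITY of `HoloInLastCoupling`**: for ANY carriers, window, channel and functional, the last-coupling dependence
`Ψ k s P U X = e^{−κd(X)}·cos s` is the restriction of the entire function `e^{−κd(X)}·cos z`, bounded by `e^{ϱ}·e^{−κd(X)}`
on the strip `|Im z| ≤ ϱ`, which contains every closed `ϱ`-disc about a real point (any real `ϱ`). [folklore] -/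
theorem toy_holoInLastCoupling {Bg ι : Type} (E : Functional C Bg) (W : Set (ℕ → ℝ))
    (T : ℕ → (ℕ → ℝ) → (Bg → C.Dom → ℝ) → ι → ℝ) (κ ϱ : ℝ) :
    HoloInLastCoupling E W T (fun _ s _ _ X => Real.exp (-(κ * C.d X)) * Real.cos s) κ (fun _ => Real.exp ϱ) ϱ := by
  intro g _ k U X _
  refine ⟨fun z => (Real.exp (-(κ * C.d X)) : ℂ) * Complex.cos z, {z | |z.im| ≤ ϱ}, ?_, ?_, ?_, ?_⟩
  · exact (Complex.differentiable_cos.const_mul _).differentiableOn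
  · intro z hz
    rw [norm_mul, Complex.norm_real, Real.norm_eq_abs, abs_of_pos (Real.exp_pos _), mul_comm]
    exact mul_le_mul_of_nonneg_right ((Literature.NumberTheory.LFunctions.norm_cos_le_exp_abs_im z).trans
      (Real.exp_le_exp.2 hz)) (Real.exp_pos _).le
  · intro g' _ z hz
    have h : |z.im - ((g' k : ℝ) : ℂ).im| ≤ ‖z - ((g' k : ℝ) : ℂ)‖ := by
      simpa using Complex.abs_im_le_norm (z - ((g' k : ℝ) : ℂ))
    have hz' : ‖z - ((g' k : ℝ) : ℂ)‖ ≤ ϱ := by simpa [dist_eq_norm] using hz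
    show |z.im| ≤ ϱ
    simpa using h.trans hz'
  · intro g' _
    push_cast
    rfl

end Literature.MathematicalPhysics.QuantumFieldTheory.Balaban1983to89.T4HistoryLipschitzLastCoupling

end
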